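import Summits.CriticalPhenomena.PercolationContinuityZ3.Theorems.PercNearOneGluingNoHeavyLowerTailFibreSwitchingHybridE3Cert
import Summits.CriticalPhenomena.PercolationContinuityZ3.Theorems.PercNearOneGluingNoHeavyLowerTailThreeCopyFibre
import Mathlib.Tactic.Ring
import Mathlib.Tactic.Linarith
import HarnessLib

/-!
# `NoHeavyLowerTail` (stmt-CriticalPhenomena-4575) — THEOREM `M(hybrid E₃)`: three-copy FIBRE (coefficientwise / comb)
# positivity of Sahi's `E₃({P₁ ≁ c}, {c ≁ P₃}, {P₁ ≁ P₃′})`, `P₃ ⊆ P₃′`, on EVERY finite graph, II: symmetrisation and theorem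

Support file (new-inequality factory seat `prim-ineq-gen-1`, gen 6; `--supports stmt-CriticalPhenomena-4575`).  No named facts,
no sorries.  Part I is `…FibreSwitchingHybridE3Cert`.

**Theorem** (`fibre_richardsKernel_hybrid_nonneg`).  For every finite vertex type `V`, `D : Finset (Sym2 V)`, vertex `c`, vertex
sets `P₁`, `P₃ ⊆ P₃′` and EVERY profile `k : Sym2 V → ℕ`:
  `0 ≤ Σ_{x ∈ fibre D k} richardsKernel (codeA x₀) (codeA x₁) (codeA x₂)`,
where `codeA` (Part I) is the membership code of a configuration in the three decreasing events `A₁ = {P₁ ≁ c}` (bit 0),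
`A₂ = {c ≁ P₃}` (bit 1), `A₃ = {P₁ ≁ P₃′}` (bit 2) and `ThreeCopy.richardsKernel` is the integer three-copy kernel of Sahi's
third-order functional (`Z = N_U N_V N_W + 9N_{UVW} − 2(N_U N_{VW} + N_V N_{UW} + N_W N_{UV})`, `E[Z] = 6·E₃`;
`ThreeCopy.cubicForm_richardsKernel`).  This is the COEFFICIENTWISE ("comb", prim-cert-2) strengthening of the law-level
theorem `HybridThreePointLB.sahiE3_hybrid_nonneg` (prim-ineq-gen-8 / prim-cert-2): since the product weight of a triple is a
nonnegative function of its profile, `E₃ ≥ 0` for every weight vector follows (`sum_wt3W_richardsKernel_hybrid_nonneg`), but the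
fibre statement says more — every coefficient of the three-copy generating polynomial is nonnegative.  Instances: `P₁ = {b}`,
`P₃ = P₃′ = {a}` is `M(SHK3⁺)` (`FibreSHK3.fibre_shk3Kernel_nonneg`); `E1/E2/DEC2`, class (b), the five-terminal rows `r0…r3` of
`HybridThreePointLB` are all comb-positive on every finite graph — the first infinite family of prim-cert-2's conjecture 'E₃ of
group separations is coefficientwise ≥ 0' to become a theorem.

**Proof.**  Part I: the fibre sum of the pointwise certificate `HybridThreePointLB.cert ≤ 0` equals the fibre sum of the table
`glamZ (codeA x₀) (codeA x₁) (codeA x₂)` (switchings are fibre bijections).  Fibres are invariant under the six permutations of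
the copies (`FibreSHK3.sum_fibre_comp_perm`), and on REALIZABLE code triples (no code `4`, `codeA_ne_four`) the copy-symmetrisation
of `glamZ` is `−richardsKernel` (`glamZ_symm`, `decide` over `8³` with the realizability guard — it fails without it).  Hence
`Σ_fibre richardsKernel = −6 Σ_fibre cert ≥ 0`.
-/

noncomputable section

namespace Summit.CriticalPhenomena.PercolationContinuityZ3.Theorems

namespace FibreHybridE3

open Finset Literature.Probability.Percolation Literature.Probability.Percolation.DecisionTree
open Literature.Probability.Percolation.Gladkov
open FibreSwitching ThreePointLB HybridThreePointLB FibreSHK3 ThreeCopy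
open scoped Classical

/-! ### The symmetrisation identity on realizable codes -/

/-- **On realizable code triples the copy-symmetrisation of the unswitched table is minus the Richards/Sahi kernel**:
for codes `l₀,l₁,l₂ < 8` (as `Fin 8`), none equal to `4`,
`Σ_{π ∈ S₃} glamZ (l_{π0}) (l_{π1}) (l_{π2}) = − richardsKernel l₀ l₁ l₂` (finite check; the law-level identity `E[S] = −E₃` of
THEOREM-HYBRID-3PTLB read coefficientwise; false without the guard `≠ 4`). [this work] -/
theorem glamZ_symm : ∀ l0 l1 l2 : Fin 8, (l0 : ℕ) ≠ 4 → (l1 : ℕ) ≠ 4 → (l2 : ℕ) ≠ 4 →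
    glamZ l0 l1 l2 + glamZ l1 l0 l2 + glamZ l2 l1 l0 + glamZ l0 l2 l1 + glamZ l2 l0 l1 + glamZ l1 l2 l0 =
      - richardsKernel l0 l1 l2 := by
  decide

variable {V : Type*} [Fintype V] [DecidableEq V]

/-! ### The theorem -/

section Main

variable (D : Finset (Sym2 V)) (c : V) (P₁ P₃ P₃' : Finset V)

/-- `(0 1)` on `Fin 3`. [folklore] -/
private theorem t01_0 : (Equiv.swap (0 : Fin 3) 1) 0 = 1 := by decide
/-- `(0 1)` on `Fin 3`. [folklore] -/
private theorem t01_1 : (Equiv.swap (0 : Fin 3) 1) 1 = 0 := by decide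
/-- `(0 1)` on `Fin 3`. [folklore] -/
private theorem t01_2 : (Equiv.swap (0 : Fin 3) 1) 2 = 2 := by decide
/-- `(0 2)` on `Fin 3`. [folklore] -/
private theorem t02_0 : (Equiv.swap (0 : Fin 3) 2) 0 = 2 := by decide
/-- `(0 2)` on `Fin 3`. [folklore] -/
private theorem t02_1 : (Equiv.swap (0 : Fin 3) 2) 1 = 1 := by decide
/-- `(0 2)` on `Fin 3`. [folklore] -/
private theorem t02_2 : (Equiv.swap (0 : Fin 3) 2) 2 = 0 := by decide
/-- `(1 2)` on `Fin 3`. [folklore] -/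
private theorem t12_0 : (Equiv.swap (1 : Fin 3) 2) 0 = 0 := by decide
/-- `(1 2)` on `Fin 3`. [folklore] -/
private theorem t12_1 : (Equiv.swap (1 : Fin 3) 2) 1 = 2 := by decide
/-- `(1 2)` on `Fin 3`. [folklore] -/
private theorem t12_2 : (Equiv.swap (1 : Fin 3) 2) 2 = 1 := by decide
/-- The 3-cycle `(0 1)(1 2)`. [folklore] -/
private theorem tr_0 : ((Equiv.swap (0 : Fin 3) 1).trans (Equiv.swap 1 2)) 0 = 2 := by decide
/-- The 3-cycle `(0 1)(1 2)`. [folklore] -/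
private theorem tr_1 : ((Equiv.swap (0 : Fin 3) 1).trans (Equiv.swap 1 2)) 1 = 0 := by decide
/-- The 3-cycle `(0 1)(1 2)`. [folklore] -/
private theorem tr_2 : ((Equiv.swap (0 : Fin 3) 1).trans (Equiv.swap 1 2)) 2 = 1 := by decide
/-- The 3-cycle `(1 2)(0 1)`. [folklore] -/
private theorem tr'_0 : ((Equiv.swap (1 : Fin 3) 2).trans (Equiv.swap 0 1)) 0 = 1 := by decide
/-- The 3-cycle `(1 2)(0 1)`. [folklore] -/
private theorem tr'_1 : ((Equiv.swap (1 : Fin 3) 2).trans (Equiv.swap 0 1)) 1 = 2 := by decide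
/-- The 3-cycle `(1 2)(0 1)`. [folklore] -/
private theorem tr'_2 : ((Equiv.swap (1 : Fin 3) 2).trans (Equiv.swap 0 1)) 2 = 0 := by decide

/-- **THEOREM `M(hybrid E₃)` — fibre positivity of Sahi's `E₃({P₁ ≁ c},{c ≁ P₃},{P₁ ≁ P₃′})` (`P₃ ⊆ P₃′`) on every finite
graph.**  For every finite vertex type `V`, `D : Finset (Sym2 V)`, `c`, `P₁`, `P₃ ⊆ P₃′` and EVERY profile `k`, the fibre sum of
`richardsKernel` of the three membership codes over the triples inside `D` with profile `k` is nonnegative.  Proof: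
`= −6 · Σ_fibre cert ≥ 0` (`sum_fibre_gcertU_nonpos`, `gcertU_eq`, copy symmetry of fibres, `glamZ_symm` with `codeA_ne_four`).
[this work] -/
theorem fibre_richardsKernel_hybrid_nonneg (hP : P₃ ⊆ P₃') (k : Sym2 V → ℕ) :
    0 ≤ ∑ x ∈ fibre D k,
      (richardsKernel (codeA c P₁ P₃ P₃' (x 0)) (codeA c P₁ P₃ P₃' (x 1)) (codeA c P₁ P₃ P₃' (x 2)) : ℝ) := by
  set g : (Fin 3 → Finset (Sym2 V)) → ℝ :=
    fun x => (glamZ (codeA c P₁ P₃ P₃' (x 0)) (codeA c P₁ P₃ P₃' (x 1)) (codeA c P₁ P₃ P₃' (x 2)) : ℝ) with hg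
  have hU : ∑ x ∈ fibre D k, g x ≤ 0 := by
    have h := sum_fibre_gcertU_nonpos c P₁ P₃ P₃' hP D k
    rw [sum_congr rfl fun x _ => gcertU_eq c P₁ P₃ P₃' hP x] at h
    exact h
  have e01 := sum_fibre_comp_perm D (Equiv.swap 0 1) k g
  have e02 := sum_fibre_comp_perm D (Equiv.swap 0 2) k g
  have e12 := sum_fibre_comp_perm D (Equiv.swap 1 2) k g
  have er := sum_fibre_comp_perm D ((Equiv.swap 0 1).trans (Equiv.swap 1 2)) k g
  have er' := sum_fibre_comp_perm D ((Equiv.swap 1 2).trans (Equiv.swap 0 1)) k g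
  simp only [hg, t01_0, t01_1, t01_2, t02_0, t02_1, t02_2, t12_0, t12_1, t12_2, tr_0, tr_1, tr_2,
    tr'_0, tr'_1, tr'_2] at e01 e02 e12 er er'
  have hsym : ∑ x ∈ fibre D k,
      (richardsKernel (codeA c P₁ P₃ P₃' (x 0)) (codeA c P₁ P₃ P₃' (x 1)) (codeA c P₁ P₃ P₃' (x 2)) : ℝ) =
      - 6 * ∑ x ∈ fibre D k, g x := by
    have h6 : 6 * ∑ x ∈ fibre D k, g x =
        ∑ x ∈ fibre D k, ((glamZ (codeA c P₁ P₃ P₃' (x 0)) (codeA c P₁ P₃ P₃' (x 1)) (codeA c P₁ P₃ P₃' (x 2)) : ℝ)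
          + (glamZ (codeA c P₁ P₃ P₃' (x 1)) (codeA c P₁ P₃ P₃' (x 0)) (codeA c P₁ P₃ P₃' (x 2)) : ℝ)
          + (glamZ (codeA c P₁ P₃ P₃' (x 2)) (codeA c P₁ P₃ P₃' (x 1)) (codeA c P₁ P₃ P₃' (x 0)) : ℝ)
          + (glamZ (codeA c P₁ P₃ P₃' (x 0)) (codeA c P₁ P₃ P₃' (x 2)) (codeA c P₁ P₃ P₃' (x 1)) : ℝ)
          + (glamZ (codeA c P₁ P₃ P₃' (x 2)) (codeA c P₁ P₃ P₃' (x 0)) (codeA c P₁ P₃ P₃' (x 1)) : ℝ)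
          + (glamZ (codeA c P₁ P₃ P₃' (x 1)) (codeA c P₁ P₃ P₃' (x 2)) (codeA c P₁ P₃ P₃' (x 0)) : ℝ)) := by
      simp only [sum_add_distrib, hg]
      rw [e01, e02, e12, er, er']
      ring
    have hpt : ∀ x : Fin 3 → Finset (Sym2 V),
        ((glamZ (codeA c P₁ P₃ P₃' (x 0)) (codeA c P₁ P₃ P₃' (x 1)) (codeA c P₁ P₃ P₃' (x 2)) : ℝ)
          + (glamZ (codeA c P₁ P₃ P₃' (x 1)) (codeA c P₁ P₃ P₃' (x 0)) (codeA c P₁ P₃ P₃' (x 2)) : ℝ)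
          + (glamZ (codeA c P₁ P₃ P₃' (x 2)) (codeA c P₁ P₃ P₃' (x 1)) (codeA c P₁ P₃ P₃' (x 0)) : ℝ)
          + (glamZ (codeA c P₁ P₃ P₃' (x 0)) (codeA c P₁ P₃ P₃' (x 2)) (codeA c P₁ P₃ P₃' (x 1)) : ℝ)
          + (glamZ (codeA c P₁ P₃ P₃' (x 2)) (codeA c P₁ P₃ P₃' (x 0)) (codeA c P₁ P₃ P₃' (x 1)) : ℝ)
          + (glamZ (codeA c P₁ P₃ P₃' (x 1)) (codeA c P₁ P₃ P₃' (x 2)) (codeA c P₁ P₃ P₃' (x 0)) : ℝ)) =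
        - (richardsKernel (codeA c P₁ P₃ P₃' (x 0)) (codeA c P₁ P₃ P₃' (x 1)) (codeA c P₁ P₃ P₃' (x 2)) : ℝ) := by
      intro x
      have h := glamZ_symm ⟨_, codeA_lt c P₁ P₃ P₃' (x 0)⟩ ⟨_, codeA_lt c P₁ P₃ P₃' (x 1)⟩
        ⟨_, codeA_lt c P₁ P₃ P₃' (x 2)⟩
        (codeA_ne_four c P₁ P₃ P₃' hP (x 0)) (codeA_ne_four c P₁ P₃ P₃' hP (x 1)) (codeA_ne_four c P₁ P₃ P₃' hP (x 2))
      exact_mod_cast h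
    rw [sum_congr rfl fun x _ => hpt x, sum_neg_distrib] at h6
    linarith
  rw [hsym]
  linarith

/-- **Corollary: `E₃ ≥ 0` for every weight vector at once, from the fibres** (the law-level theorem
`HybridThreePointLB.hybrid_PrW` / `sahiE3_hybrid_nonneg`, recovered via `FibreSwitching.sum_wt3W_mul_nonneg_of_fibres`). [this work] -/
theorem sum_wt3W_richardsKernel_hybrid_nonneg (hP : P₃ ⊆ P₃') {p : Sym2 V → ℝ} (hp0 : ∀ i, 0 ≤ p i) (hp1 : ∀ i, p i ≤ 1) :
    0 ≤ ∑ x ∈ triples D, wt3W D p x *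
      (richardsKernel (codeA c P₁ P₃ P₃' (x 0)) (codeA c P₁ P₃ P₃' (x 1)) (codeA c P₁ P₃ P₃' (x 2)) : ℝ) :=
  sum_wt3W_mul_nonneg_of_fibres D hp0 hp1 _ fun k => fibre_richardsKernel_hybrid_nonneg D c P₁ P₃ P₃' hP k

end Main

end FibreHybridE3

end Summit.CriticalPhenomena.PercolationContinuityZ3.Theorems

end
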